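import Summits.QuantumFields.BalabanUV.Beta.CompositeHessianTable
import Summits.QuantumFields.BalabanUV.Beta.CompositeVertexKernelRecTwo
import Literature.MathematicalPhysics.QuantumFieldTheory.Balaban1983to89.Beta.AveragingMixedJetTables

/-!
# `BalabanUV.Beta.CompositeMixedTable` — row D1 ∕ (C1), file F6c part 1 (brick-generic): THE m-FOLD COMPOSITE AVERAGING's MIXED
# (one background ∕ two fluctuation bonds) THIRD-ORDER KERNEL BY THE TOP-PEELED CHAIN RULE, and its packing as the `mixFF` member of the
# composite table record

WHAT.  Over the bricks of F3 (`ℓ m` linear, `𝓋 m` mixed second order), F6a's Hessian brick `𝒽 m` (two fluctuation bonds) and ONE more brick —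
the one-step MIXED third-order kernel `𝓉 m μ y g f f′` (background bond `g` FIRST, then the ordered fluctuation pair; an1's `mixKerAt (toSite (r m)) L` ∕
`symMixKerAt`) — the composite's mixed kernel `compMixKer ℓ 𝓋 𝒽 𝓉 L m μ y g f f′` is DEFINED by the FIVE-SUMMAND top-peeled chain rule (F5's slot-type rule:
a lower composite derivative's output bond is FLUCTUATION-type; the top brick is chosen by the slot types; background slots are transported linearly):
  top `𝓉 m` along the three transported bonds ({g}{f}{f′})
  + top `𝒽 m` fed by the lower MIXED vertex `compVHKer ℓ 𝓋 L m · f g` in one fluctuation slot and the transported `f′` in the other ({f,g}{f′}), and symmetrically ({f′,g}{f})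
  + top `𝓋 m` fed by the lower composite HESSIAN `compVHKer ℓ 𝒽 L m · f f′` (F6a's kernel) in its fluctuation slot and the transported `g` in its background slot ({f,f′}{g})
  + top `ℓ m` composed with the lower composite's own mixed kernel ({f,f′,g}).
§1 the definition + unfoldings; §2 ANCHOR `compMixKer_one` (depth one IS the level-`0` brick; F5a's `sum_window3_mul_indicator`); §3 SUPPORT in each of the three finest
bonds by induction (`compMixKer_eq_zero_bg ∕ _left ∕ _right`, window `winF (L^m) (wid L m)`); §4 BLOCK-TRANSLATION COVARIANCE `compMixKer_sh`; §5 the PACKED TABLE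
`compMixFF ℓ 𝓋 𝒽 𝓉 L m κ u μ y := packFF (fun μ y f f′ => compMixKer … m μ y (κ,u) f f′) μ y` (the shape of an1's `mixFFAt ρ L κ u μ y`), its (Tmix)-shape covariance
`compMixFF_translate`, and the (R) ANCHOR `compMixFF_rooted_one = mixFFAt (toSite (r 0)) L`.  Bounds ∕ (Lmix) and the (S)∕(RS) instantiations are part 2.

WHY (located).  F6 SPEC ADDENDUM S-an2-g51-1 v1.2 §7 (`HOME/b2b-balaban-beta-an2/gen51/F6-SPEC-ADDENDUM.v1_2.md`): the `mixFF` member of the composite record ∕ the `M₂` table of the composite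
system's `W2SymOfK` word.  The five-summand shape is the row's DESIGN by F5's rule (F5's four summands are machine-checked against leaf-02's `compIns₂₂` by R-17); it is STAGED
statement-first and files only after a consumer shape confirms it (INTENT I-an2-g51-4).  [folklore] finite sums ∕ inductions over OUR typed objects; two [our object — bookkeeping]
definitions (`compMixKer`, `compMixFF`).  Nothing of Bałaban's asserted, valued or discharged; 0 estimates; 0∕4 row-D1 binders; NOT (C1), NOT D1, NEVER «G-an2-4 closed», NOT BetaPertH,
NOT continuum, NOT Clay.

HONEST DEPENDENCY (page 1, mandatory): continuum YM on T⁴ ⇐ BetaPertH ∧ nine spine estimates (0/9 proved); BetaPertH ⇐ (D1) ∧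
(D4) ∧ CAP+tail; G-an2-4 gates asym, D1 and NE2/3/4.  Row D1 ∕ (C1) OWNER an2, gen 51, 2026-08-23.  No existing file touched.
-/

noncomputable section

open scoped BigOperators

namespace Summit.QuantumFields.BalabanUV.Beta.CompositeMixedTable

open Finset
open Literature.MathematicalPhysics.QuantumFieldTheory.Balaban1983to89
open Literature.MathematicalPhysics.QuantumFieldTheory.Balaban1983to89.Beta
open AffineAveraging (Site box toSite)
open AveragingHessianKernels (Bond Near)
open AveragingHessianKernelsRooted (linKerAt vhKerAt hessKerAt)
open AveragingMixedJetTables (mixKerAt mixFFAt)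
open ExpKernelCalculus (MKer shiftK)
open OneStepResolventKernel (Fib)
open Summit.QuantumFields.BalabanUV.Beta.CompositeVertexKernelRec (offs winF wid compLinKer compVHKer compLinKer_zero compVHKer_zero
  compLinKer_eq_zero compVHKer_eq_zero_left compVHKer_eq_zero_right compLinKer_sh compVHKer_sh window_bond_sh mem_winF_zero_iff mem_winF_succ_of_offs
  sum_window3_mul_indicator)
open Summit.QuantumFields.BalabanUV.Beta.CompositeHessianTable (packFF packFF_inl_inl packFF_inl_inr packFF_inr packFF_translate)

variable {d : ℕ}

/-! ## §1 The composite mixed kernel -/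

variable (ℓ : ℕ → Fin (d + 1) → Site (d + 1) → Bond (d + 1) → ℝ)
  (𝓋 𝒽 : ℕ → Fin (d + 1) → Site (d + 1) → Bond (d + 1) → Bond (d + 1) → ℝ)
  (𝓉 : ℕ → Fin (d + 1) → Site (d + 1) → Bond (d + 1) → Bond (d + 1) → Bond (d + 1) → ℝ) (L : ℕ)

/-- [our object — bookkeeping] **THE COMPOSITE MIXED THIRD-ORDER KERNEL, TOP-PEELED** (slots: background bond `g`; fluctuation bonds `f`, `f′`; all finest):
`0` at depth `0`; at depth `m+1` the five summands of the chain rule (see the file header). -/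
def compMixKer : ℕ → Fin (d + 1) → Site (d + 1) → Bond (d + 1) → Bond (d + 1) → Bond (d + 1) → ℝ
  | 0, _, _, _, _, _ => 0
  | m + 1, μ, y, g, f, f' =>
      (∑ κ : Fin (d + 1), ∑ e ∈ offs L, ∑ κ₁ : Fin (d + 1), ∑ e₁ ∈ offs L, ∑ κ₂ : Fin (d + 1), ∑ e₂ ∈ offs L,
          𝓉 m μ y (κ, (L : ℤ) • y + e) (κ₁, (L : ℤ) • y + e₁) (κ₂, (L : ℤ) • y + e₂)
            * compLinKer ℓ L m g (κ, (L : ℤ) • y + e) * compLinKer ℓ L m f (κ₁, (L : ℤ) • y + e₁)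
            * compLinKer ℓ L m f' (κ₂, (L : ℤ) • y + e₂))
        + (∑ κ₁ : Fin (d + 1), ∑ e₁ ∈ offs L, ∑ κ₂ : Fin (d + 1), ∑ e₂ ∈ offs L,
            𝒽 m μ y (κ₁, (L : ℤ) • y + e₁) (κ₂, (L : ℤ) • y + e₂)
              * compVHKer ℓ 𝓋 L m κ₁ ((L : ℤ) • y + e₁) f g * compLinKer ℓ L m f' (κ₂, (L : ℤ) • y + e₂))
        + (∑ κ₁ : Fin (d + 1), ∑ e₁ ∈ offs L, ∑ κ₂ : Fin (d + 1), ∑ e₂ ∈ offs L,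
            𝒽 m μ y (κ₁, (L : ℤ) • y + e₁) (κ₂, (L : ℤ) • y + e₂)
              * compLinKer ℓ L m f (κ₁, (L : ℤ) • y + e₁) * compVHKer ℓ 𝓋 L m κ₂ ((L : ℤ) • y + e₂) f' g)
        + (∑ κ₁ : Fin (d + 1), ∑ e₁ ∈ offs L, ∑ κ : Fin (d + 1), ∑ e ∈ offs L,
            𝓋 m μ y (κ₁, (L : ℤ) • y + e₁) (κ, (L : ℤ) • y + e)
              * compVHKer ℓ 𝒽 L m κ₁ ((L : ℤ) • y + e₁) f f' * compLinKer ℓ L m g (κ, (L : ℤ) • y + e))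
        + ∑ κ : Fin (d + 1), ∑ e ∈ offs L,
            ℓ m μ y (κ, (L : ℤ) • y + e) * compMixKer m κ ((L : ℤ) • y + e) g f f'

/-- [our object — bookkeeping] **THE PACKED COMPOSITE MIXED TABLE AT BLOCKING `L^m`** (the shape of an1's `mixFFAt ρ L κ u μ y`): per finest background bond
`(κ, u)` and level-`m` bond `(μ, y)`, the field–field kernel `((x, inl α), (x′, inl α′)) ↦ compMixKer … m μ y (κ, u) (α, x) (α′, x′)`. -/
def compMixFF (m : ℕ) (κ : Fin (d + 1)) (u : Site (d + 1)) : Fin (d + 1) → Site (d + 1) → MKer (d + 1) (Fib d) :=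
  packFF (fun μ y f f' => compMixKer ℓ 𝓋 𝒽 𝓉 L m μ y (κ, u) f f')

variable {ℓ 𝓋 𝒽 𝓉 L}

/-- unfolding, depth `0`. -/
@[simp] theorem compMixKer_zero (μ : Fin (d + 1)) (y : Site (d + 1)) (g f f' : Bond (d + 1)) :
    compMixKer ℓ 𝓋 𝒽 𝓉 L 0 μ y g f f' = 0 := rfl

/-- unfolding, depth `m+1` (TOP-PEEL by `rfl`). -/
theorem compMixKer_succ (m : ℕ) (μ : Fin (d + 1)) (y : Site (d + 1)) (g f f' : Bond (d + 1)) :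
    compMixKer ℓ 𝓋 𝒽 𝓉 L (m + 1) μ y g f f' =
      (∑ κ : Fin (d + 1), ∑ e ∈ offs L, ∑ κ₁ : Fin (d + 1), ∑ e₁ ∈ offs L, ∑ κ₂ : Fin (d + 1), ∑ e₂ ∈ offs L,
          𝓉 m μ y (κ, (L : ℤ) • y + e) (κ₁, (L : ℤ) • y + e₁) (κ₂, (L : ℤ) • y + e₂)
            * compLinKer ℓ L m g (κ, (L : ℤ) • y + e) * compLinKer ℓ L m f (κ₁, (L : ℤ) • y + e₁)
            * compLinKer ℓ L m f' (κ₂, (L : ℤ) • y + e₂))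
        + (∑ κ₁ : Fin (d + 1), ∑ e₁ ∈ offs L, ∑ κ₂ : Fin (d + 1), ∑ e₂ ∈ offs L,
            𝒽 m μ y (κ₁, (L : ℤ) • y + e₁) (κ₂, (L : ℤ) • y + e₂)
              * compVHKer ℓ 𝓋 L m κ₁ ((L : ℤ) • y + e₁) f g * compLinKer ℓ L m f' (κ₂, (L : ℤ) • y + e₂))
        + (∑ κ₁ : Fin (d + 1), ∑ e₁ ∈ offs L, ∑ κ₂ : Fin (d + 1), ∑ e₂ ∈ offs L,
            𝒽 m μ y (κ₁, (L : ℤ) • y + e₁) (κ₂, (L : ℤ) • y + e₂)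
              * compLinKer ℓ L m f (κ₁, (L : ℤ) • y + e₁) * compVHKer ℓ 𝓋 L m κ₂ ((L : ℤ) • y + e₂) f' g)
        + (∑ κ₁ : Fin (d + 1), ∑ e₁ ∈ offs L, ∑ κ : Fin (d + 1), ∑ e ∈ offs L,
            𝓋 m μ y (κ₁, (L : ℤ) • y + e₁) (κ, (L : ℤ) • y + e)
              * compVHKer ℓ 𝒽 L m κ₁ ((L : ℤ) • y + e₁) f f' * compLinKer ℓ L m g (κ, (L : ℤ) • y + e))
        + ∑ κ : Fin (d + 1), ∑ e ∈ offs L,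
            ℓ m μ y (κ, (L : ℤ) • y + e) * compMixKer ℓ 𝓋 𝒽 𝓉 L m κ ((L : ℤ) • y + e) g f f' := rfl

/-- [folklore] The field–field entries of the packed composite mixed table. -/
@[simp] theorem compMixFF_inl_inl (m : ℕ) (κ : Fin (d + 1)) (u : Site (d + 1)) (μ : Fin (d + 1)) (y x x' : Site (d + 1)) (α α' : Fin (d + 1)) :
    compMixFF ℓ 𝓋 𝒽 𝓉 L m κ u μ y x x' (Sum.inl α) (Sum.inl α') = compMixKer ℓ 𝓋 𝒽 𝓉 L m μ y (κ, u) (α, x) (α', x') := rfl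

/-! ## §2 Anchor: depth one IS the level-`0` mixed brick -/

/-- [folklore] ANCHOR: the depth-one composite mixed kernel IS the level-`0` brick (support letters of the brick used off the window, each slot). -/
theorem compMixKer_one (h₁ : ∀ m μ y g f f', ¬ Near L y g.2 → 𝓉 m μ y g f f' = 0) (h₂ : ∀ m μ y g f f', ¬ Near L y f.2 → 𝓉 m μ y g f f' = 0)
    (h₃ : ∀ m μ y g f f', ¬ Near L y f'.2 → 𝓉 m μ y g f f' = 0) (μ : Fin (d + 1)) (y : Site (d + 1)) (g f f' : Bond (d + 1)) :
    compMixKer ℓ 𝓋 𝒽 𝓉 L 1 μ y g f f' = 𝓉 0 μ y g f f' := by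
  rw [compMixKer_succ]
  simp only [compMixKer_zero, compVHKer_zero, compLinKer_zero, mul_zero, zero_mul, Finset.sum_const_zero, add_zero]
  exact sum_window3_mul_indicator (fun a b c => 𝓉 0 μ y a b c) y g f f' (fun b c h => h₁ 0 μ y g b c h)
    (fun a c h => h₂ 0 μ y a f c h) (fun a b h => h₃ 0 μ y a b f' h)

/-! ## §3 Support by induction -/

/-- [folklore] SUPPORT IN THE BACKGROUND BOND. -/
theorem compMixKer_eq_zero_bg : ∀ (m : ℕ) {μ : Fin (d + 1)} {y : Site (d + 1)} {g : Bond (d + 1)} (f f' : Bond (d + 1)),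
    g.2 ∉ winF (L ^ m) (wid L m) y → compMixKer ℓ 𝓋 𝒽 𝓉 L m μ y g f f' = 0
  | 0, _, _, _, _, _, _ => rfl
  | m + 1, μ, y, g, f, f', h => by
      rw [compMixKer_succ]
      have A : ∀ κ, ∀ e ∈ offs L, compLinKer ℓ L m g (κ, (L : ℤ) • y + e) = 0 :=
        fun κ e he => compLinKer_eq_zero m fun hn => h (mem_winF_succ_of_offs he hn)
      have B : ∀ κ, ∀ e ∈ offs L, compVHKer ℓ 𝓋 L m κ ((L : ℤ) • y + e) f g = 0 :=
        fun κ e he => compVHKer_eq_zero_right m f fun hn => h (mem_winF_succ_of_offs he hn)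
      have B' : ∀ κ, ∀ e ∈ offs L, compVHKer ℓ 𝓋 L m κ ((L : ℤ) • y + e) f' g = 0 :=
        fun κ e he => compVHKer_eq_zero_right m f' fun hn => h (mem_winF_succ_of_offs he hn)
      have C : ∀ κ, ∀ e ∈ offs L, compMixKer ℓ 𝓋 𝒽 𝓉 L m κ ((L : ℤ) • y + e) g f f' = 0 :=
        fun κ e he => compMixKer_eq_zero_bg m f f' fun hn => h (mem_winF_succ_of_offs he hn)
      have S1 : (∑ κ : Fin (d + 1), ∑ e ∈ offs L, ∑ κ₁ : Fin (d + 1), ∑ e₁ ∈ offs L, ∑ κ₂ : Fin (d + 1), ∑ e₂ ∈ offs L,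
          𝓉 m μ y (κ, (L : ℤ) • y + e) (κ₁, (L : ℤ) • y + e₁) (κ₂, (L : ℤ) • y + e₂)
            * compLinKer ℓ L m g (κ, (L : ℤ) • y + e) * compLinKer ℓ L m f (κ₁, (L : ℤ) • y + e₁)
            * compLinKer ℓ L m f' (κ₂, (L : ℤ) • y + e₂)) = 0 :=
        Finset.sum_eq_zero fun κ _ => Finset.sum_eq_zero fun e he => Finset.sum_eq_zero fun κ₁ _ => Finset.sum_eq_zero fun e₁ _ =>
          Finset.sum_eq_zero fun κ₂ _ => Finset.sum_eq_zero fun e₂ _ => by rw [A κ e he, mul_zero, zero_mul, zero_mul]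
      have S2 : (∑ κ₁ : Fin (d + 1), ∑ e₁ ∈ offs L, ∑ κ₂ : Fin (d + 1), ∑ e₂ ∈ offs L,
          𝒽 m μ y (κ₁, (L : ℤ) • y + e₁) (κ₂, (L : ℤ) • y + e₂)
            * compVHKer ℓ 𝓋 L m κ₁ ((L : ℤ) • y + e₁) f g * compLinKer ℓ L m f' (κ₂, (L : ℤ) • y + e₂)) = 0 :=
        Finset.sum_eq_zero fun κ₁ _ => Finset.sum_eq_zero fun e₁ he₁ => Finset.sum_eq_zero fun κ₂ _ => Finset.sum_eq_zero fun e₂ _ => by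
          rw [B κ₁ e₁ he₁, mul_zero, zero_mul]
      have S3 : (∑ κ₁ : Fin (d + 1), ∑ e₁ ∈ offs L, ∑ κ₂ : Fin (d + 1), ∑ e₂ ∈ offs L,
          𝒽 m μ y (κ₁, (L : ℤ) • y + e₁) (κ₂, (L : ℤ) • y + e₂)
            * compLinKer ℓ L m f (κ₁, (L : ℤ) • y + e₁) * compVHKer ℓ 𝓋 L m κ₂ ((L : ℤ) • y + e₂) f' g) = 0 :=
        Finset.sum_eq_zero fun κ₁ _ => Finset.sum_eq_zero fun e₁ _ => Finset.sum_eq_zero fun κ₂ _ => Finset.sum_eq_zero fun e₂ he₂ => by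
          rw [B' κ₂ e₂ he₂, mul_zero]
      have S4 : (∑ κ₁ : Fin (d + 1), ∑ e₁ ∈ offs L, ∑ κ : Fin (d + 1), ∑ e ∈ offs L,
          𝓋 m μ y (κ₁, (L : ℤ) • y + e₁) (κ, (L : ℤ) • y + e)
            * compVHKer ℓ 𝒽 L m κ₁ ((L : ℤ) • y + e₁) f f' * compLinKer ℓ L m g (κ, (L : ℤ) • y + e)) = 0 :=
        Finset.sum_eq_zero fun κ₁ _ => Finset.sum_eq_zero fun e₁ _ => Finset.sum_eq_zero fun κ _ => Finset.sum_eq_zero fun e he => by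
          rw [A κ e he, mul_zero]
      have S5 : (∑ κ : Fin (d + 1), ∑ e ∈ offs L, ℓ m μ y (κ, (L : ℤ) • y + e) * compMixKer ℓ 𝓋 𝒽 𝓉 L m κ ((L : ℤ) • y + e) g f f') = 0 :=
        Finset.sum_eq_zero fun κ _ => Finset.sum_eq_zero fun e he => by rw [C κ e he, mul_zero]
      rw [S1, S2, S3, S4, S5]; ring

/-- [folklore] SUPPORT IN THE FIRST FLUCTUATION BOND. -/
theorem compMixKer_eq_zero_left : ∀ (m : ℕ) {μ : Fin (d + 1)} {y : Site (d + 1)} (g : Bond (d + 1)) {f : Bond (d + 1)} (f' : Bond (d + 1)),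
    f.2 ∉ winF (L ^ m) (wid L m) y → compMixKer ℓ 𝓋 𝒽 𝓉 L m μ y g f f' = 0
  | 0, _, _, _, _, _, _ => rfl
  | m + 1, μ, y, g, f, f', h => by
      rw [compMixKer_succ]
      have A : ∀ κ, ∀ e ∈ offs L, compLinKer ℓ L m f (κ, (L : ℤ) • y + e) = 0 :=
        fun κ e he => compLinKer_eq_zero m fun hn => h (mem_winF_succ_of_offs he hn)
      have B : ∀ κ, ∀ e ∈ offs L, compVHKer ℓ 𝓋 L m κ ((L : ℤ) • y + e) f g = 0 :=
        fun κ e he => compVHKer_eq_zero_left m g fun hn => h (mem_winF_succ_of_offs he hn)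
      have B' : ∀ κ, ∀ e ∈ offs L, compVHKer ℓ 𝒽 L m κ ((L : ℤ) • y + e) f f' = 0 :=
        fun κ e he => compVHKer_eq_zero_left m f' fun hn => h (mem_winF_succ_of_offs he hn)
      have C : ∀ κ, ∀ e ∈ offs L, compMixKer ℓ 𝓋 𝒽 𝓉 L m κ ((L : ℤ) • y + e) g f f' = 0 :=
        fun κ e he => compMixKer_eq_zero_left m g f' fun hn => h (mem_winF_succ_of_offs he hn)
      have S1 : (∑ κ : Fin (d + 1), ∑ e ∈ offs L, ∑ κ₁ : Fin (d + 1), ∑ e₁ ∈ offs L, ∑ κ₂ : Fin (d + 1), ∑ e₂ ∈ offs L,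
          𝓉 m μ y (κ, (L : ℤ) • y + e) (κ₁, (L : ℤ) • y + e₁) (κ₂, (L : ℤ) • y + e₂)
            * compLinKer ℓ L m g (κ, (L : ℤ) • y + e) * compLinKer ℓ L m f (κ₁, (L : ℤ) • y + e₁)
            * compLinKer ℓ L m f' (κ₂, (L : ℤ) • y + e₂)) = 0 :=
        Finset.sum_eq_zero fun κ _ => Finset.sum_eq_zero fun e _ => Finset.sum_eq_zero fun κ₁ _ => Finset.sum_eq_zero fun e₁ he₁ =>
          Finset.sum_eq_zero fun κ₂ _ => Finset.sum_eq_zero fun e₂ _ => by rw [A κ₁ e₁ he₁, mul_zero, zero_mul]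
      have S2 : (∑ κ₁ : Fin (d + 1), ∑ e₁ ∈ offs L, ∑ κ₂ : Fin (d + 1), ∑ e₂ ∈ offs L,
          𝒽 m μ y (κ₁, (L : ℤ) • y + e₁) (κ₂, (L : ℤ) • y + e₂)
            * compVHKer ℓ 𝓋 L m κ₁ ((L : ℤ) • y + e₁) f g * compLinKer ℓ L m f' (κ₂, (L : ℤ) • y + e₂)) = 0 :=
        Finset.sum_eq_zero fun κ₁ _ => Finset.sum_eq_zero fun e₁ he₁ => Finset.sum_eq_zero fun κ₂ _ => Finset.sum_eq_zero fun e₂ _ => by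
          rw [B κ₁ e₁ he₁, mul_zero, zero_mul]
      have S3 : (∑ κ₁ : Fin (d + 1), ∑ e₁ ∈ offs L, ∑ κ₂ : Fin (d + 1), ∑ e₂ ∈ offs L,
          𝒽 m μ y (κ₁, (L : ℤ) • y + e₁) (κ₂, (L : ℤ) • y + e₂)
            * compLinKer ℓ L m f (κ₁, (L : ℤ) • y + e₁) * compVHKer ℓ 𝓋 L m κ₂ ((L : ℤ) • y + e₂) f' g) = 0 :=
        Finset.sum_eq_zero fun κ₁ _ => Finset.sum_eq_zero fun e₁ he₁ => Finset.sum_eq_zero fun κ₂ _ => Finset.sum_eq_zero fun e₂ _ => by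
          rw [A κ₁ e₁ he₁, mul_zero, zero_mul]
      have S4 : (∑ κ₁ : Fin (d + 1), ∑ e₁ ∈ offs L, ∑ κ : Fin (d + 1), ∑ e ∈ offs L,
          𝓋 m μ y (κ₁, (L : ℤ) • y + e₁) (κ, (L : ℤ) • y + e)
            * compVHKer ℓ 𝒽 L m κ₁ ((L : ℤ) • y + e₁) f f' * compLinKer ℓ L m g (κ, (L : ℤ) • y + e)) = 0 :=
        Finset.sum_eq_zero fun κ₁ _ => Finset.sum_eq_zero fun e₁ he₁ => Finset.sum_eq_zero fun κ _ => Finset.sum_eq_zero fun e _ => by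
          rw [B' κ₁ e₁ he₁, mul_zero, zero_mul]
      have S5 : (∑ κ : Fin (d + 1), ∑ e ∈ offs L, ℓ m μ y (κ, (L : ℤ) • y + e) * compMixKer ℓ 𝓋 𝒽 𝓉 L m κ ((L : ℤ) • y + e) g f f') = 0 :=
        Finset.sum_eq_zero fun κ _ => Finset.sum_eq_zero fun e he => by rw [C κ e he, mul_zero]
      rw [S1, S2, S3, S4, S5]; ring

/-- [folklore] SUPPORT IN THE SECOND FLUCTUATION BOND. -/
theorem compMixKer_eq_zero_right : ∀ (m : ℕ) {μ : Fin (d + 1)} {y : Site (d + 1)} (g f : Bond (d + 1)) {f' : Bond (d + 1)},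
    f'.2 ∉ winF (L ^ m) (wid L m) y → compMixKer ℓ 𝓋 𝒽 𝓉 L m μ y g f f' = 0
  | 0, _, _, _, _, _, _ => rfl
  | m + 1, μ, y, g, f, f', h => by
      rw [compMixKer_succ]
      have A : ∀ κ, ∀ e ∈ offs L, compLinKer ℓ L m f' (κ, (L : ℤ) • y + e) = 0 :=
        fun κ e he => compLinKer_eq_zero m fun hn => h (mem_winF_succ_of_offs he hn)
      have B : ∀ κ, ∀ e ∈ offs L, compVHKer ℓ 𝓋 L m κ ((L : ℤ) • y + e) f' g = 0 :=
        fun κ e he => compVHKer_eq_zero_left m g fun hn => h (mem_winF_succ_of_offs he hn)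
      have B' : ∀ κ, ∀ e ∈ offs L, compVHKer ℓ 𝒽 L m κ ((L : ℤ) • y + e) f f' = 0 :=
        fun κ e he => compVHKer_eq_zero_right m f fun hn => h (mem_winF_succ_of_offs he hn)
      have C : ∀ κ, ∀ e ∈ offs L, compMixKer ℓ 𝓋 𝒽 𝓉 L m κ ((L : ℤ) • y + e) g f f' = 0 :=
        fun κ e he => compMixKer_eq_zero_right m g f fun hn => h (mem_winF_succ_of_offs he hn)
      have S1 : (∑ κ : Fin (d + 1), ∑ e ∈ offs L, ∑ κ₁ : Fin (d + 1), ∑ e₁ ∈ offs L, ∑ κ₂ : Fin (d + 1), ∑ e₂ ∈ offs L,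
          𝓉 m μ y (κ, (L : ℤ) • y + e) (κ₁, (L : ℤ) • y + e₁) (κ₂, (L : ℤ) • y + e₂)
            * compLinKer ℓ L m g (κ, (L : ℤ) • y + e) * compLinKer ℓ L m f (κ₁, (L : ℤ) • y + e₁)
            * compLinKer ℓ L m f' (κ₂, (L : ℤ) • y + e₂)) = 0 :=
        Finset.sum_eq_zero fun κ _ => Finset.sum_eq_zero fun e _ => Finset.sum_eq_zero fun κ₁ _ => Finset.sum_eq_zero fun e₁ _ =>
          Finset.sum_eq_zero fun κ₂ _ => Finset.sum_eq_zero fun e₂ he₂ => by rw [A κ₂ e₂ he₂, mul_zero]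
      have S2 : (∑ κ₁ : Fin (d + 1), ∑ e₁ ∈ offs L, ∑ κ₂ : Fin (d + 1), ∑ e₂ ∈ offs L,
          𝒽 m μ y (κ₁, (L : ℤ) • y + e₁) (κ₂, (L : ℤ) • y + e₂)
            * compVHKer ℓ 𝓋 L m κ₁ ((L : ℤ) • y + e₁) f g * compLinKer ℓ L m f' (κ₂, (L : ℤ) • y + e₂)) = 0 :=
        Finset.sum_eq_zero fun κ₁ _ => Finset.sum_eq_zero fun e₁ _ => Finset.sum_eq_zero fun κ₂ _ => Finset.sum_eq_zero fun e₂ he₂ => by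
          rw [A κ₂ e₂ he₂, mul_zero]
      have S3 : (∑ κ₁ : Fin (d + 1), ∑ e₁ ∈ offs L, ∑ κ₂ : Fin (d + 1), ∑ e₂ ∈ offs L,
          𝒽 m μ y (κ₁, (L : ℤ) • y + e₁) (κ₂, (L : ℤ) • y + e₂)
            * compLinKer ℓ L m f (κ₁, (L : ℤ) • y + e₁) * compVHKer ℓ 𝓋 L m κ₂ ((L : ℤ) • y + e₂) f' g) = 0 :=
        Finset.sum_eq_zero fun κ₁ _ => Finset.sum_eq_zero fun e₁ _ => Finset.sum_eq_zero fun κ₂ _ => Finset.sum_eq_zero fun e₂ he₂ => by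
          rw [B κ₂ e₂ he₂, mul_zero]
      have S4 : (∑ κ₁ : Fin (d + 1), ∑ e₁ ∈ offs L, ∑ κ : Fin (d + 1), ∑ e ∈ offs L,
          𝓋 m μ y (κ₁, (L : ℤ) • y + e₁) (κ, (L : ℤ) • y + e)
            * compVHKer ℓ 𝒽 L m κ₁ ((L : ℤ) • y + e₁) f f' * compLinKer ℓ L m g (κ, (L : ℤ) • y + e)) = 0 :=
        Finset.sum_eq_zero fun κ₁ _ => Finset.sum_eq_zero fun e₁ he₁ => Finset.sum_eq_zero fun κ _ => Finset.sum_eq_zero fun e _ => by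
          rw [B' κ₁ e₁ he₁, mul_zero, zero_mul]
      have S5 : (∑ κ : Fin (d + 1), ∑ e ∈ offs L, ℓ m μ y (κ, (L : ℤ) • y + e) * compMixKer ℓ 𝓋 𝒽 𝓉 L m κ ((L : ℤ) • y + e) g f f') = 0 :=
        Finset.sum_eq_zero fun κ _ => Finset.sum_eq_zero fun e he => by rw [C κ e he, mul_zero]
      rw [S1, S2, S3, S4, S5]; ring

/-! ## §4 Block-translation covariance -/

/-- [folklore] COVARIANCE OF THE COMPOSITE MIXED KERNEL under block translations (finest bonds by `L^m·t`, level-`m` bond by `t`). -/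
theorem compMixKer_sh (hℓsh : ∀ m μ y t f, ℓ m μ (y + t) (f.sh ((L : ℤ) • t)) = ℓ m μ y f)
    (h𝓋sh : ∀ m μ y t f f', 𝓋 m μ (y + t) (f.sh ((L : ℤ) • t)) (f'.sh ((L : ℤ) • t)) = 𝓋 m μ y f f')
    (h𝒽sh : ∀ m μ y t f f', 𝒽 m μ (y + t) (f.sh ((L : ℤ) • t)) (f'.sh ((L : ℤ) • t)) = 𝒽 m μ y f f')
    (h𝓉sh : ∀ m μ y t g f f', 𝓉 m μ (y + t) (g.sh ((L : ℤ) • t)) (f.sh ((L : ℤ) • t)) (f'.sh ((L : ℤ) • t)) = 𝓉 m μ y g f f')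
    (m : ℕ) (g f f' : Bond (d + 1)) :
    ∀ (μ : Fin (d + 1)) (y t : Site (d + 1)),
      compMixKer ℓ 𝓋 𝒽 𝓉 L m μ (y + t) (g.sh ((L : ℤ) ^ m • t)) (f.sh ((L : ℤ) ^ m • t)) (f'.sh ((L : ℤ) ^ m • t))
        = compMixKer ℓ 𝓋 𝒽 𝓉 L m μ y g f f' := by
  induction m with
  | zero => intro μ y t; rw [compMixKer_zero, compMixKer_zero]
  | succ m ih =>
      intro μ y t
      rw [compMixKer_succ, compMixKer_succ]
      have e3 : (L : ℤ) ^ (m + 1) • t = (L : ℤ) ^ m • ((L : ℤ) • t) := by rw [pow_succ, mul_smul]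
      have e4 : ∀ e : Site (d + 1), (L : ℤ) • (y + t) + e = ((L : ℤ) • y + e) + (L : ℤ) • t := fun e => by
        rw [smul_add]; abel
      have T1 : ∀ κ κ₁ κ₂ (e e₁ e₂ : Site (d + 1)),
          𝓉 m μ (y + t) (κ, (L : ℤ) • (y + t) + e) (κ₁, (L : ℤ) • (y + t) + e₁) (κ₂, (L : ℤ) • (y + t) + e₂)
            * compLinKer ℓ L m (g.sh ((L : ℤ) ^ (m + 1) • t)) (κ, (L : ℤ) • (y + t) + e)
            * compLinKer ℓ L m (f.sh ((L : ℤ) ^ (m + 1) • t)) (κ₁, (L : ℤ) • (y + t) + e₁)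
            * compLinKer ℓ L m (f'.sh ((L : ℤ) ^ (m + 1) • t)) (κ₂, (L : ℤ) • (y + t) + e₂)
          = 𝓉 m μ y (κ, (L : ℤ) • y + e) (κ₁, (L : ℤ) • y + e₁) (κ₂, (L : ℤ) • y + e₂)
            * compLinKer ℓ L m g (κ, (L : ℤ) • y + e) * compLinKer ℓ L m f (κ₁, (L : ℤ) • y + e₁)
            * compLinKer ℓ L m f' (κ₂, (L : ℤ) • y + e₂) := by
        intro κ κ₁ κ₂ e e₁ e₂
        rw [window_bond_sh L κ, window_bond_sh L κ₁, window_bond_sh L κ₂, h𝓉sh, e3, compLinKer_sh hℓsh, compLinKer_sh hℓsh,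
          compLinKer_sh hℓsh]
      have T2 : ∀ κ₁ κ₂ (e₁ e₂ : Site (d + 1)) (a c c' : Bond (d + 1)),
          𝒽 m μ (y + t) (κ₁, (L : ℤ) • (y + t) + e₁) (κ₂, (L : ℤ) • (y + t) + e₂)
            * compVHKer ℓ 𝓋 L m κ₁ ((L : ℤ) • (y + t) + e₁) (a.sh ((L : ℤ) ^ (m + 1) • t)) (c.sh ((L : ℤ) ^ (m + 1) • t))
            * compLinKer ℓ L m (c'.sh ((L : ℤ) ^ (m + 1) • t)) (κ₂, (L : ℤ) • (y + t) + e₂)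
          = 𝒽 m μ y (κ₁, (L : ℤ) • y + e₁) (κ₂, (L : ℤ) • y + e₂)
            * compVHKer ℓ 𝓋 L m κ₁ ((L : ℤ) • y + e₁) a c * compLinKer ℓ L m c' (κ₂, (L : ℤ) • y + e₂) := by
        intro κ₁ κ₂ e₁ e₂ a c c'
        rw [window_bond_sh L κ₁, window_bond_sh L κ₂, h𝒽sh, e3, compLinKer_sh hℓsh, e4 e₁, compVHKer_sh hℓsh h𝓋sh]
      have T3 : ∀ κ₁ κ₂ (e₁ e₂ : Site (d + 1)) (a c c' : Bond (d + 1)),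
          𝒽 m μ (y + t) (κ₁, (L : ℤ) • (y + t) + e₁) (κ₂, (L : ℤ) • (y + t) + e₂)
            * compLinKer ℓ L m (c'.sh ((L : ℤ) ^ (m + 1) • t)) (κ₁, (L : ℤ) • (y + t) + e₁)
            * compVHKer ℓ 𝓋 L m κ₂ ((L : ℤ) • (y + t) + e₂) (a.sh ((L : ℤ) ^ (m + 1) • t)) (c.sh ((L : ℤ) ^ (m + 1) • t))
          = 𝒽 m μ y (κ₁, (L : ℤ) • y + e₁) (κ₂, (L : ℤ) • y + e₂)
            * compLinKer ℓ L m c' (κ₁, (L : ℤ) • y + e₁) * compVHKer ℓ 𝓋 L m κ₂ ((L : ℤ) • y + e₂) a c := by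
        intro κ₁ κ₂ e₁ e₂ a c c'
        rw [window_bond_sh L κ₁, window_bond_sh L κ₂, h𝒽sh, e3, compLinKer_sh hℓsh, e4 e₂, compVHKer_sh hℓsh h𝓋sh]
      have T4 : ∀ κ₁ κ (e₁ e : Site (d + 1)) (a c c' : Bond (d + 1)),
          𝓋 m μ (y + t) (κ₁, (L : ℤ) • (y + t) + e₁) (κ, (L : ℤ) • (y + t) + e)
            * compVHKer ℓ 𝒽 L m κ₁ ((L : ℤ) • (y + t) + e₁) (a.sh ((L : ℤ) ^ (m + 1) • t)) (c.sh ((L : ℤ) ^ (m + 1) • t))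
            * compLinKer ℓ L m (c'.sh ((L : ℤ) ^ (m + 1) • t)) (κ, (L : ℤ) • (y + t) + e)
          = 𝓋 m μ y (κ₁, (L : ℤ) • y + e₁) (κ, (L : ℤ) • y + e)
            * compVHKer ℓ 𝒽 L m κ₁ ((L : ℤ) • y + e₁) a c * compLinKer ℓ L m c' (κ, (L : ℤ) • y + e) := by
        intro κ₁ κ e₁ e a c c'
        rw [window_bond_sh L κ₁, window_bond_sh L κ, h𝓋sh, e3, compLinKer_sh hℓsh, e4 e₁, compVHKer_sh hℓsh h𝒽sh]
      have T5 : ∀ κ (e : Site (d + 1)),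
          ℓ m μ (y + t) (κ, (L : ℤ) • (y + t) + e)
            * compMixKer ℓ 𝓋 𝒽 𝓉 L m κ ((L : ℤ) • (y + t) + e) (g.sh ((L : ℤ) ^ (m + 1) • t)) (f.sh ((L : ℤ) ^ (m + 1) • t))
                (f'.sh ((L : ℤ) ^ (m + 1) • t))
          = ℓ m μ y (κ, (L : ℤ) • y + e) * compMixKer ℓ 𝓋 𝒽 𝓉 L m κ ((L : ℤ) • y + e) g f f' := by
        intro κ e
        rw [window_bond_sh, hℓsh, e3, e4 e, ih κ ((L : ℤ) • y + e) ((L : ℤ) • t)]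
      simp_rw [T1, T2, T3, T4, T5]

/-! ## §5 The packed table: covariance and the rooted anchor -/

/-- [folklore] **(Tmix)-SHAPE COVARIANCE OF THE PACKED COMPOSITE MIXED TABLE**: background bond by `L^m·t`, level-`m` bond by `t`
(an1's `mixFFAt_translate` byte shape at blocking `L^m`). -/
theorem compMixFF_translate (hℓsh : ∀ m μ y t f, ℓ m μ (y + t) (f.sh ((L : ℤ) • t)) = ℓ m μ y f)
    (h𝓋sh : ∀ m μ y t f f', 𝓋 m μ (y + t) (f.sh ((L : ℤ) • t)) (f'.sh ((L : ℤ) • t)) = 𝓋 m μ y f f')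
    (h𝒽sh : ∀ m μ y t f f', 𝒽 m μ (y + t) (f.sh ((L : ℤ) • t)) (f'.sh ((L : ℤ) • t)) = 𝒽 m μ y f f')
    (h𝓉sh : ∀ m μ y t g f f', 𝓉 m μ (y + t) (g.sh ((L : ℤ) • t)) (f.sh ((L : ℤ) • t)) (f'.sh ((L : ℤ) • t)) = 𝓉 m μ y g f f')
    (m : ℕ) (κ : Fin (d + 1)) (u : Site (d + 1)) (μ : Fin (d + 1)) (y t : Site (d + 1)) :
    compMixFF ℓ 𝓋 𝒽 𝓉 L m κ (u + ((L ^ m : ℕ) : ℤ) • t) μ (y + t) = shiftK (-(((L ^ m : ℕ) : ℤ) • t)) (compMixFF ℓ 𝓋 𝒽 𝓉 L m κ u μ y) := by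
  funext x x' a b
  simp only [shiftK]
  rcases a with α | ν
  · rcases b with α' | ν'
    · rw [compMixFF_inl_inl, compMixFF_inl_inl, Nat.cast_pow]
      have h := compMixKer_sh hℓsh h𝓋sh h𝒽sh h𝓉sh m ((κ, u) : Bond (d + 1)) (α, x + -((L : ℤ) ^ m • t))
        (α', x' + -((L : ℤ) ^ m • t)) μ y t
      simp only [Bond.sh, neg_add_cancel_right] at h
      exact h
    · rfl
  · cases b <;> rfl

/-- [folklore] **(Tmix) in the record's letter shape**. -/
theorem compMixFF_hmixt (hℓsh : ∀ m μ y t f, ℓ m μ (y + t) (f.sh ((L : ℤ) • t)) = ℓ m μ y f)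
    (h𝓋sh : ∀ m μ y t f f', 𝓋 m μ (y + t) (f.sh ((L : ℤ) • t)) (f'.sh ((L : ℤ) • t)) = 𝓋 m μ y f f')
    (h𝒽sh : ∀ m μ y t f f', 𝒽 m μ (y + t) (f.sh ((L : ℤ) • t)) (f'.sh ((L : ℤ) • t)) = 𝒽 m μ y f f')
    (h𝓉sh : ∀ m μ y t g f f', 𝓉 m μ (y + t) (g.sh ((L : ℤ) • t)) (f.sh ((L : ℤ) • t)) (f'.sh ((L : ℤ) • t)) = 𝓉 m μ y g f f') (m : ℕ) :
    ∀ (κ : Fin (d + 1)) (u : Site (d + 1)) (μ : Fin (d + 1)) (w t : Site (d + 1)),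
      compMixFF ℓ 𝓋 𝒽 𝓉 L m κ (u + ((L ^ m : ℕ) : ℤ) • t) μ (w + t) = shiftK (-(((L ^ m : ℕ) : ℤ) • t)) (compMixFF ℓ 𝓋 𝒽 𝓉 L m κ u μ w) :=
  fun κ u μ w t => compMixFF_translate hℓsh h𝓋sh h𝒽sh h𝓉sh m κ u μ w t

/-! ## §6 The rooted instantiation: anchor -/

section Rooted

variable {r : ℕ → (Fin (d + 1) → ℕ)}

/-- [folklore] (R) ANCHOR: over an1's ROOTED bricks (`mixKerAt` as the third) the depth-one composite mixed kernel IS `mixKerAt (toSite (r 0)) L`. -/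
theorem compMixKer_rooted_one (hr : ∀ k, r k ∈ box (d + 1) L) (μ : Fin (d + 1)) (y : Site (d + 1)) (g f f' : Bond (d + 1)) :
    compMixKer (fun m => linKerAt (toSite (r m)) L) (fun m => vhKerAt (toSite (r m)) L) (fun m => hessKerAt (toSite (r m)) L)
        (fun m => mixKerAt (toSite (r m)) L) L 1 μ y g f f'
      = mixKerAt (toSite (r 0)) L μ y g f f' := by
  refine compMixKer_one (fun m μ y g f f' h => ?_) (fun m μ y g f f' h => ?_) (fun m μ y g f f' h => ?_) μ y g f f'
  · show ((AveragingMixedJetTables.tTab (toSite (r m)) L μ y f f' g : ℚ) : ℝ) = 0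
    rw [AveragingMixedJetTables.tTab_eq_zero₃ (hr m) μ y f f' h, Rat.cast_zero]
  · show ((AveragingMixedJetTables.tTab (toSite (r m)) L μ y f f' g : ℚ) : ℝ) = 0
    rw [AveragingMixedJetTables.tTab_eq_zero₁ (hr m) μ y h f' g, Rat.cast_zero]
  · show ((AveragingMixedJetTables.tTab (toSite (r m)) L μ y f f' g : ℚ) : ℝ) = 0
    rw [AveragingMixedJetTables.tTab_eq_zero₂ (hr m) μ y f h g, Rat.cast_zero]

/-- [folklore] (R) ANCHOR AT THE TABLE LEVEL: the depth-one packed composite mixed table IS an1's `mixFFAt (toSite (r 0)) L`. -/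
theorem compMixFF_rooted_one (hr : ∀ k, r k ∈ box (d + 1) L) :
    compMixFF (fun m => linKerAt (toSite (r m)) L) (fun m => vhKerAt (toSite (r m)) L) (fun m => hessKerAt (toSite (r m)) L)
        (fun m => mixKerAt (toSite (r m)) L) L 1
      = mixFFAt (toSite (r 0)) L := by
  funext κ u μ y x x' a b
  rcases a with α | ν
  · rcases b with α' | ν'
    · rw [compMixFF_inl_inl, AveragingMixedJetTables.mixFFAt_inl_inl]
      exact compMixKer_rooted_one hr μ y (κ, u) (α, x) (α', x')
    · rfl
  · cases b <;> rfl

/-- [folklore] (R) (Tmix): translation covariance of the rooted composite mixed table at blocking `L^m`. -/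
theorem compMixFF_rooted_translate (m : ℕ) (κ : Fin (d + 1)) (u : Site (d + 1)) (μ : Fin (d + 1)) (y t : Site (d + 1)) :
    compMixFF (fun m => linKerAt (toSite (r m)) L) (fun m => vhKerAt (toSite (r m)) L) (fun m => hessKerAt (toSite (r m)) L)
        (fun m => mixKerAt (toSite (r m)) L) L m κ (u + ((L ^ m : ℕ) : ℤ) • t) μ (y + t)
      = shiftK (-(((L ^ m : ℕ) : ℤ) • t))
          (compMixFF (fun m => linKerAt (toSite (r m)) L) (fun m => vhKerAt (toSite (r m)) L) (fun m => hessKerAt (toSite (r m)) L)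
            (fun m => mixKerAt (toSite (r m)) L) L m κ u μ y) :=
  compMixFF_translate (ℓ := fun m => linKerAt (toSite (r m)) L) (𝓋 := fun m => vhKerAt (toSite (r m)) L)
    (𝒽 := fun m => hessKerAt (toSite (r m)) L) (𝓉 := fun m => mixKerAt (toSite (r m)) L)
    (fun m μ y t f => AveragingHessianKernelsRooted.linKerAt_add (toSite (r m)) L μ y t f)
    (fun m μ y t f f' => AveragingHessianKernelsRooted.vhKerAt_add (toSite (r m)) L μ y t f f')
    (fun m μ y t f f' => AveragingHessianKernelsRooted.hessKerAt_add (toSite (r m)) L μ y t f f')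
    (fun m μ y t g f f' => AveragingMixedJetTables.mixKerAt_add (toSite (r m)) L μ y t g f f') m κ u μ y t

end Rooted

end Summit.QuantumFields.BalabanUV.Beta.CompositeMixedTable

end
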